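import Literature.AlgebraicGeometry.HodgeTheory.KunnethStandardConjectureDominations
import Literature.AlgebraicGeometry.Motives.FibrePowerFan
import HarnessLib

/-!
# The Künneth standard conjecture for the powers `X^{m+1}` of a variety with `C(X)`, and for every
# variety dominated by a power of a curve, of a surface, of an abelian variety

Family `hodge`, layer `Literature/AlgebraicGeometry/HodgeTheory`; lane `lit-hodgefound`. THEOREMS ONLY
(no definition, no named fact; D-0026). Kahn, *Zeta and L-functions of varieties and motives* (2020),
§6.9 Lemma 6.30 (3) ("if the `p^*_M` and the `p^*_N` are algebraic, then the `p^*_{M ⊗ N}` are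
algebraic", `p^k_{M⊗N} = Σ_{i+j=k} p^i_M ⊗ p^j_N`) and (2) (direct summands), Theorem 6.31 ((1)–(2):
`C` in dimension `≤ 2`; (3): abelian varieties, Lieberman–Kleiman). On the tree's carriers
(`kunnethPiece`, `diagonalClass`, `algebraicClasses`) and explicit cartesian powers
`Motives.powObj X m = X^{m+1}` (`powObj X (m+1) = X ⊗ powObj X m`, of dimension `n (m+1)`,
`Motives.isSmoothProjective_powObj`):

* §1 `kunnethComponents_algebraic_of_dim_eq` (transport of "all Künneth components of all Künneth
  decompositions of `cl(Δ_Y)` are algebraic" along an equality of dimension indices);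
  **`kunnethComponents_algebraic_powObj` — `C(X) ⟹ C(X^{m+1})` for every `m`** (induction on `m` by
  `C(X) ∧ C(Y) ⟹ C(X ⊗ Y)`, the tree's `kunnethComponent_diagonalClass_mem_algebraicClasses_tensor_of_forall`);
  unconditional instances `…_powObj_of_le_two` (ALL POWERS OF A SMOOTH PROJECTIVE CURVE OR SURFACE),
  `…_powObj_abelianVariety`.
* §2 with the descent of `C` along every surjection (`kunnethComponents_algebraic_of_surjective`,
  `KunnethStandardConjectureDominations`): **`kunnethComponents_algebraic_of_surjective_powObj`** (`C(W)`
  for `W` dominated by a power of a variety with `C`), **`…_of_surjective_powObj_of_le_two` — EVERY SMOOTH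
  PROJECTIVE COMPLEX VARIETY DOMINATED BY A POWER `Cᴺ` OF A CURVE OR `Sᴺ` OF A SURFACE SATISFIES `C`**
  (e.g. symmetric powers of curves, varieties dominated by a power of a curve), `…_abelianVariety`,
  `…_of_surjective_powObj_tensor_powObj_of_le_two` (`Cᵃ × Sᵇ ↠ W`).

## References

* [Kahn2020] B. Kahn, Zeta and L-functions of varieties and motives, LMS LN 462, CUP 2020, §6.9
  Lemma 6.30 (2)–(3) (p. 125) and Theorem 6.31 (1)–(3).
* [Kleiman1968AlgebraicCycles] S. Kleiman, Algebraic cycles and the Weil conjectures (1968), §2,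
  Appendix (2A11).
* [Voisin2025] C. Voisin, Hodge and generalized Hodge conjectures, coniveau and algebraic cycles,
  J. Open Math. Probl. 1 (2025), §3.2.1 Cor. 3.9.
* [Voisin2002] C. Voisin, Hodge Theory and Complex Algebraic Geometry I, CUP 2002, §7.3.2 Lemma 7.28.
-/

noncomputable section

open CategoryTheory AlgebraicGeometry MonoidalCategory CartesianMonoidalCategory Finset
open Literature.AlgebraicTopology.SingularHomology Literature.Geometry.Kaehler
open Literature.AlgebraicGeometry.Motives (IsSmoothProjective ComplexPoints powObj isSmoothProjective_powObj)

namespace Literature.AlgebraicGeometry.HodgeTheory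

variable {n m k d : ℕ} {X W Y : Motives.SchemeOver ℂ}

/-! ### §1 `C(X) ⟹ C(X^{m+1})` -/

/-- Transport of "every Künneth component of every Künneth decomposition of `cl(Δ_Y)` is algebraic"
along an equality `d = d'` of dimension indices (the witnesses `IsSmoothProjective d Y` are
propositions). [cite: Kahn2020, §6.9 Def. 6.29] -/
theorem kunnethComponents_algebraic_of_dim_eq {d d' : ℕ} (hd : d = d') (hY : IsSmoothProjective d Y)
    (hY' : IsSmoothProjective d' Y)
    (hC : ∀ (π : Fin (2 * d + 1) → complexBetti (Y ⊗ Y) (2 * d)),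
      (∀ i : Fin (2 * d + 1), π i ∈ kunnethPiece Y Y (show (2 * d - (i : ℕ)) + i = 2 * d by omega)) →
      ∑ i, π i = diagonalClass hY → ∀ i, π i ∈ algebraicClasses (Y ⊗ Y) d)
    {π : Fin (2 * d' + 1) → complexBetti (Y ⊗ Y) (2 * d')}
    (hπ : ∀ i : Fin (2 * d' + 1), π i ∈ kunnethPiece Y Y (show (2 * d' - (i : ℕ)) + i = 2 * d' by omega))
    (hΔ : ∑ i, π i = diagonalClass hY') (i : Fin (2 * d' + 1)) :
    π i ∈ algebraicClasses (Y ⊗ Y) d' := by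
  subst hd
  exact hC π hπ hΔ i

/-- **`C(X) ⟹ C(X^{m+1})` for every `m`** (Kahn Lemma 6.30 (3) iterated: `X^{m+2} = X ⊗ X^{m+1}` and
`C(X) ∧ C(Y) ⟹ C(X ⊗ Y)`, the tree's `kunnethComponent_diagonalClass_mem_algebraicClasses_tensor_of_forall`),
for the explicit cartesian powers `powObj X m` of dimension `n (m+1)`. [cite: Kahn2020, §6.9 Lemma 6.30 (3)]
[cite: Kleiman1968AlgebraicCycles, §2] -/
theorem kunnethComponents_algebraic_powObj (hX : IsSmoothProjective n X)
    (hCX : ∀ (πX : Fin (2 * n + 1) → complexBetti (X ⊗ X) (2 * n)),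
      (∀ i : Fin (2 * n + 1), πX i ∈ kunnethPiece X X (show (2 * n - (i : ℕ)) + i = 2 * n by omega)) →
      ∑ i, πX i = diagonalClass hX → ∀ i, πX i ∈ algebraicClasses (X ⊗ X) n)
    (m : ℕ) :
    ∀ {π : Fin (2 * (n * (m + 1)) + 1) → complexBetti (powObj X m ⊗ powObj X m) (2 * (n * (m + 1)))}
      (_ : ∀ i : Fin (2 * (n * (m + 1)) + 1), π i ∈ kunnethPiece (powObj X m) (powObj X m)
        (show (2 * (n * (m + 1)) - (i : ℕ)) + i = 2 * (n * (m + 1)) by omega))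
      (_ : ∑ i, π i = diagonalClass (isSmoothProjective_powObj hX m)) (i : Fin (2 * (n * (m + 1)) + 1)),
      π i ∈ algebraicClasses (powObj X m ⊗ powObj X m) (n * (m + 1)) := by
  induction m with
  | zero =>
    intro π hπ hΔ i
    exact kunnethComponents_algebraic_of_dim_eq (show n = n * (0 + 1) by ring) hX
      (isSmoothProjective_powObj hX 0) hCX hπ hΔ i
  | succ m ih =>
    intro π hπ hΔ i
    have hP : IsSmoothProjective (n * (m + 1)) (powObj X m) := isSmoothProjective_powObj hX m
    exact kunnethComponents_algebraic_of_dim_eq (show n + n * (m + 1) = n * (m + 1 + 1) by ring)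
      (Motives.IsSmoothProjective.tensor_holds hX hP) (isSmoothProjective_powObj hX (m + 1))
      (fun π' hπ' hΔ' j ↦ kunnethComponent_diagonalClass_mem_algebraicClasses_tensor_of_forall hX hP hCX
        (fun π'' hπ'' hΔ'' j' ↦ ih hπ'' hΔ'' j') hπ' hΔ' j) hπ hΔ i

/-- **`C` FOR ALL POWERS OF A SMOOTH PROJECTIVE CURVE OR SURFACE** (`dim X ≤ 2`): `C` holds in dimension
`≤ 2` (Voisin 2025 Cor. 3.9 / Kahn Thm. 6.31 (1)–(2),
`kunnethComponent_diagonalClass_mem_algebraicClasses_of_le_two`) and passes to powers.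
[cite: Kahn2020, §6.9 Lemma 6.30 (3) and Theorem 6.31 (1)–(2)] [cite: Voisin2025, §3.2.1 Cor. 3.9] -/
theorem kunnethComponents_algebraic_powObj_of_le_two (hX : IsSmoothProjective n X) (hn : n ≤ 2) (m : ℕ)
    {π : Fin (2 * (n * (m + 1)) + 1) → complexBetti (powObj X m ⊗ powObj X m) (2 * (n * (m + 1)))}
    (hπ : ∀ i : Fin (2 * (n * (m + 1)) + 1), π i ∈ kunnethPiece (powObj X m) (powObj X m)
      (show (2 * (n * (m + 1)) - (i : ℕ)) + i = 2 * (n * (m + 1)) by omega))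
    (hΔ : ∑ i, π i = diagonalClass (isSmoothProjective_powObj hX m)) (i : Fin (2 * (n * (m + 1)) + 1)) :
    π i ∈ algebraicClasses (powObj X m ⊗ powObj X m) (n * (m + 1)) :=
  kunnethComponents_algebraic_powObj hX
    (fun _ hπX hΔX j ↦ kunnethComponent_diagonalClass_mem_algebraicClasses_of_le_two hX hn hπX hΔX j) m hπ hΔ i

/-- **`C` for all powers `A^{m+1}` of a complex abelian variety** (as explicit cartesian powers of `A.X`;
Lieberman–Kleiman `C(A)`, the tree's `AbelianVariety.kunnethComponent_diagonalClass_mem_algebraicClasses`, and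
§1). [cite: Kahn2020, §6.9 Lemma 6.30 (3) and Theorem 6.31 (3)] [cite: Kleiman1968AlgebraicCycles, §2 Appendix (2A11)] -/
theorem kunnethComponents_algebraic_powObj_abelianVariety (A : Motives.AbelianVariety ℂ) (m : ℕ)
    {π : Fin (2 * (A.dim * (m + 1)) + 1) → complexBetti (powObj A.X m ⊗ powObj A.X m) (2 * (A.dim * (m + 1)))}
    (hπ : ∀ i : Fin (2 * (A.dim * (m + 1)) + 1), π i ∈ kunnethPiece (powObj A.X m) (powObj A.X m)
      (show (2 * (A.dim * (m + 1)) - (i : ℕ)) + i = 2 * (A.dim * (m + 1)) by omega))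
    (hΔ : ∑ i, π i = diagonalClass
      (isSmoothProjective_powObj (Motives.AbelianVariety.isSmoothProjective_holds (A := A)) m))
    (i : Fin (2 * (A.dim * (m + 1)) + 1)) :
    π i ∈ algebraicClasses (powObj A.X m ⊗ powObj A.X m) (A.dim * (m + 1)) :=
  kunnethComponents_algebraic_powObj (Motives.AbelianVariety.isSmoothProjective_holds (A := A))
    (fun _ hπA hΔA j ↦ A.kunnethComponent_diagonalClass_mem_algebraicClasses hπA hΔA j) m hπ hΔ i

/-! ### §2 Varieties dominated by a power -/

/-- **`C(W)` for every `W` dominated by a power `X^{m+1}` of a variety with `C(X)`** (surjective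
`g : powObj X m ⟶ W`, any relative dimension: §1 and the descent of `C` along every surjection,
`kunnethComponents_algebraic_of_surjective`). [cite: Kahn2020, §6.9 Lemma 6.30 (2)–(3)]
[cite: Voisin2002, §7.3.2 Lemma 7.28] -/
theorem kunnethComponents_algebraic_of_surjective_powObj (hX : IsSmoothProjective n X)
    (hCX : ∀ (πX : Fin (2 * n + 1) → complexBetti (X ⊗ X) (2 * n)),
      (∀ i : Fin (2 * n + 1), πX i ∈ kunnethPiece X X (show (2 * n - (i : ℕ)) + i = 2 * n by omega)) →
      ∑ i, πX i = diagonalClass hX → ∀ i, πX i ∈ algebraicClasses (X ⊗ X) n)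
    (m : ℕ) (hW : IsSmoothProjective k W) (g : powObj X m ⟶ W) [Surjective g.left]
    {πW : Fin (2 * k + 1) → complexBetti (W ⊗ W) (2 * k)}
    (hπW : ∀ i : Fin (2 * k + 1), πW i ∈ kunnethPiece W W (show (2 * k - (i : ℕ)) + i = 2 * k by omega))
    (hΔW : ∑ i, πW i = diagonalClass hW) (i : Fin (2 * k + 1)) :
    πW i ∈ algebraicClasses (W ⊗ W) k :=
  kunnethComponents_algebraic_of_surjective (isSmoothProjective_powObj hX m) hW g
    (fun _ hπ hΔ j ↦ kunnethComponents_algebraic_powObj hX hCX m hπ hΔ j) hπW hΔW i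

/-- **EVERY SMOOTH PROJECTIVE COMPLEX VARIETY DOMINATED BY A POWER OF A CURVE OR OF A SURFACE SATISFIES
THE KÜNNETH STANDARD CONJECTURE** (a surjective MORPHISM `g : X^{m+1} ⟶ W`, `dim X ≤ 2`, any relative
dimension — e.g. the symmetric powers of a curve, every variety dominated by a power of one curve).
[cite: Kahn2020, §6.9 Lemma 6.30 (2)–(3) and Theorem 6.31 (1)–(2)] [cite: Voisin2025, §3.2.1 Cor. 3.9]
[cite: Voisin2002, §7.3.2 Lemma 7.28] -/
theorem kunnethComponents_algebraic_of_surjective_powObj_of_le_two (hX : IsSmoothProjective n X)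
    (hn : n ≤ 2) (m : ℕ) (hW : IsSmoothProjective k W) (g : powObj X m ⟶ W) [Surjective g.left]
    {πW : Fin (2 * k + 1) → complexBetti (W ⊗ W) (2 * k)}
    (hπW : ∀ i : Fin (2 * k + 1), πW i ∈ kunnethPiece W W (show (2 * k - (i : ℕ)) + i = 2 * k by omega))
    (hΔW : ∑ i, πW i = diagonalClass hW) (i : Fin (2 * k + 1)) :
    πW i ∈ algebraicClasses (W ⊗ W) k :=
  kunnethComponents_algebraic_of_surjective_powObj hX
    (fun _ hπX hΔX j ↦ kunnethComponent_diagonalClass_mem_algebraicClasses_of_le_two hX hn hπX hΔX j) m hW g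
    hπW hΔW i

/-- **`C(W)` for every `W` dominated by a power of a complex abelian variety** (as explicit cartesian
power `powObj A.X m`). [cite: Kahn2020, §6.9 Lemma 6.30 (2)–(3) and Theorem 6.31 (3)]
[cite: Voisin2002, §7.3.2 Lemma 7.28] -/
theorem kunnethComponents_algebraic_of_surjective_powObj_abelianVariety (A : Motives.AbelianVariety ℂ)
    (m : ℕ) (hW : IsSmoothProjective k W) (g : powObj A.X m ⟶ W) [Surjective g.left]
    {πW : Fin (2 * k + 1) → complexBetti (W ⊗ W) (2 * k)}
    (hπW : ∀ i : Fin (2 * k + 1), πW i ∈ kunnethPiece W W (show (2 * k - (i : ℕ)) + i = 2 * k by omega))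
    (hΔW : ∑ i, πW i = diagonalClass hW) (i : Fin (2 * k + 1)) :
    πW i ∈ algebraicClasses (W ⊗ W) k :=
  kunnethComponents_algebraic_of_surjective_powObj (Motives.AbelianVariety.isSmoothProjective_holds (A := A))
    (fun _ hπA hΔA j ↦ A.kunnethComponent_diagonalClass_mem_algebraicClasses hπA hΔA j) m hW g hπW hΔW i

/-- **`C(W)` for every `W` dominated by a product `X^{a+1} ⊗ Y^{b+1}` of powers of two varieties of
dimension `≤ 2`** (e.g. `Cᵃ × Sᵇ ↠ W` for a curve `C` and a surface `S`; any relative dimension).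
[cite: Kahn2020, §6.9 Lemma 6.30 (2)–(3) and Theorem 6.31 (1)–(2)] [cite: Voisin2025, §3.2.1 Cor. 3.9] -/
theorem kunnethComponents_algebraic_of_surjective_powObj_tensor_powObj_of_le_two
    (hX : IsSmoothProjective n X) (hY : IsSmoothProjective d Y) (hn : n ≤ 2) (hd : d ≤ 2) (a b : ℕ)
    (hW : IsSmoothProjective k W) (g : powObj X a ⊗ powObj Y b ⟶ W) [Surjective g.left]
    {πW : Fin (2 * k + 1) → complexBetti (W ⊗ W) (2 * k)}
    (hπW : ∀ i : Fin (2 * k + 1), πW i ∈ kunnethPiece W W (show (2 * k - (i : ℕ)) + i = 2 * k by omega))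
    (hΔW : ∑ i, πW i = diagonalClass hW) (i : Fin (2 * k + 1)) :
    πW i ∈ algebraicClasses (W ⊗ W) k :=
  kunnethComponents_algebraic_of_surjective_tensor (isSmoothProjective_powObj hX a)
    (isSmoothProjective_powObj hY b) hW g
    (fun _ hπ hΔ j ↦ kunnethComponents_algebraic_powObj_of_le_two hX hn a hπ hΔ j)
    (fun _ hπ hΔ j ↦ kunnethComponents_algebraic_powObj_of_le_two hY hd b hπ hΔ j) hπW hΔW i

end Literature.AlgebraicGeometry.HodgeTheory

end
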